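import Summits.ResolutionOfSingularities.ResolutionOfSingularities.Theorems.MarkedTransferCampaignW13BypassRFlatFailure
import Literature.AlgebraicGeometry.Hironaka2017.NegaWitness
import Literature.RingTheory.MvPolynomial.VariableIdeals
import Mathlib.FieldTheory.Finite.Polynomial
import Mathlib.RingTheory.Multiplicity
import Mathlib.Algebra.MvPolynomial.Division
import HarnessLib

/-!
# [OURS · L1 W1.4 / K1.4 (ii), kernel] The ARC LEMMA for the typed algebraic `℘`, target-generic and prime by prime,
# and the FROBENIUS ARC of W1 = `(y² + xw², 2)` over `𝔽₂` (seat res-L1-k14, kill test K1.4, slot W1.4 «elimination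
# algebra instead of negative modules», KILL-TEST-ONLY; verdict ALIVE(A) of record 2026-08-27T02:19:59Z)

LADDER-RESOLUTION rung L (rescue), cell `res-hironaka`; host `--supports stmt-ResolutionOfSingularities-15522`
(MarkedTransfer `HypersurfaceToMarked`, the G1 campaign host) like the sibling K1.4 file
`MarkedTransferCampaignW14K14ElimWitnesses.lean` (p486835). This is part I (machinery) of the kernel closure of the
K1.4 report's cell «F1 transform law: kernel-general OPEN (valuative upper bound on `℘`, priced 1–2 prover-days)»
(`L/res-L1-k14/KILL-TEST-K1.4.md` §4 (β), §5); part II, `MarkedTransferCampaignW14K14ElimLaw.lean`, derives from it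
`J_k(Ě_{W1}, β) = (w^{2k})` for all `k` and the literal instance of res-L1-type-o2's `CampaignW14.ElimTransformLawChart`
on W1's `x`-chart.

HONEST FRAMING. Nothing here is a statement of H. Hironaka's manuscript (2017-03-23, [Hironaka2017]) nor of
Villamayor 2007 / Bravo–Villamayor 2010, and nothing asserts that any printed statement holds. The objects are the
tree's REAL definitions — Grothendieck's differential operators `Resolution.IsDiffOpLE` / `Resolution.diffIdeal`
(EGA IV₄ 16.8) and row 003's typed ALGEBRAIC `℘` `S04CharAlgebra.pAlgebraicRing K O J b` (U17_2, p.17 l.8–11: the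
integral closure in `O[X]` of the Diff-algebra `S04CharAlgebra.diffSubalgebra`; a CANDIDATE definition under
adjudication) — and EXPLICIT polynomials over `𝔽₂` (`Nega.g3 = y² + xw²`, `Nega.xChart` of `NegaWitness.lean`, the
R04 calibration witness). Every theorem is elementary commutative algebra about these objects (tag [folklore]); AI
review is weaker than expert review; not progress on resolution of singularities in positive characteristic; no claim
beyond the kernel. No `sorry`; axioms standard. Template: `MarkedTransferCampaignW46CuspArc.lean` (res-L0-k46), whose
arc lemma is specific to the cusp `yᵖ + xⁿ` and to arcs into `K[τ]`; here the target ring, the element `m` measuring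
arc order, and the prime are parameters, and the differential input is coordinate-free.

## What is proved
§1 (any `K`-algebra `O`, any ring map `ψ : O → T` — an «arc» —, any `m ∈ T`): `coeff_dvd_of_mem_diffSubalgebra` — if
   every value `D f` (`D` of order `≤ j < b`, `f ∈ J`) has `m^{b−j} ∣ ψ(D f)` then the degree-`d` coefficients of the
   Diff-algebra have `m^d ∣ ψ(·)`; `pow_dvd_of_monic_relation_prime` — `w^N + Σ c_i w^i = 0`, `π^{(N−i)M} ∣ c_i`, `π`
   prime in a domain `⇒ π^M ∣ w` (bare hands); **`prime_pow_dvd_of_monomial_mem`** — THE ARC LEMMA: `a·X^k ∈ ℘`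
   (INTEGRAL CLOSURE included) and `π^e ∣ m` `⇒ π^{ek} ∣ ψ a`.
§2 (any commutative `R`-algebra): `apply_eq_mul_of_isDiffOpLE_zero` (`D f = D1·f`); the order-`≤ 1` identity
   `D(ab) = a·Db + b·Da − ab·D1` (evaluate `[[D,a],b] = 0` at `1`) is the tree's `Campaign.W13.apply_mul_of_isDiffOpLE_one`
   (`MarkedTransferCampaignW13BypassRFlatFailure.lean`, res-L1-s13; reused, not restated).
§3 W1: `W1_apply_g3_of_isDiffOpLE_one` (`D(y² + xw²) = −y²·D1 + w²·Dx` in characteristic `2`), **`W1_gen_dvd`** — for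
   EVERY arc `ψ` killing `g` and every `f ∈ (g)`, `D` of order `≤ j < 2`: `(ψ(w)²)^{2−j} ∣ ψ(D f)` —, `W1_prime_pow_dvd`
   (`π^e ∣ ψ(w)²`, `a·X^k ∈ ℘(Ě_{W1})` `⇒ π^{ek} ∣ ψ a`).
§4 the Frobenius arc `φ : 𝔽₂[x,y,w] → 𝔽₂[s,t]`, `x ↦ s²`, `y ↦ st²`, `w ↦ t²` (any `𝔽₂`-algebra map with these values):
   `frobArc_g3` (kills `g = (y + √x·w)²`), `frobArc_rename` (on the base `β^* = rename ![0,2]` it is the Frobenius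
   `c ↦ c²`, `MvPolynomial.expand_zmod`), `frobArc_xChart_g3/X0/X2` (composed with `Nega.xChart`: `ψ(w) = s²t²`);
   primes of `𝔽₂[s,t]`: `prime_X_fin2`, `not_X_one_dvd_X_zero_pow`, `pow_dvd_of_sq` (`π^{2n} ∣ c² ⇒ π^n ∣ c`).

## References
* H. Hironaka, ms. 2017-03-23, §4 p.17 l.8–11 (U17_2) — scope only, under adjudication. [Hironaka2017]
* A. Grothendieck, J. Dieudonné, ÉGA IV₄ §16.8, Déf. 16.8.1 / Prop. 16.8.8 (tree `Resolution.DifferentialOperators`).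
  [EGAIV4]
* O. Villamayor U., Adv. Math. 213 (2007) = arXiv:math/0606796, Th 4.11; A. Bravo, O. Villamayor U., Adv. Math. 224
  (2010) = arXiv:0807.4308, Th 3.1 — scope of the slot only. [Villamayor2007] [BravoVillamayor2010]
* Cell res-hironaka: `L/res-L1-k14/KILL-TEST-K1.4.md`, kit j265389, p486835; template
  `Theorems/MarkedTransferCampaignW46CuspArc.lean`.
-/

noncomputable section

set_option linter.dupNamespace false -- mandated namespace of this single-conjunct summit

namespace Summit.ResolutionOfSingularities.ResolutionOfSingularities.Theorems.Campaign.W14.Law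

open Literature.AlgebraicGeometry.Resolution
open Literature.AlgebraicGeometry.Hironaka2017
open Literature.AlgebraicGeometry.Hironaka2017.S04CharAlgebra (homogPiece pAlgebraicRing diffSubalgebra)
open Summit.ResolutionOfSingularities.ResolutionOfSingularities.Theorems.Campaign.W13 (apply_mul_of_isDiffOpLE_one)
open MvPolynomial (X rename aeval)

universe u v

/-! ## §1 Generic arc machinery for the typed algebraic `℘` (any `K`-algebra `O`, any target ring `T`) -/

section Generic

variable {K O : Type u} [CommRing K] [CommRing O] [Algebra K O] {T : Type v} [CommRing T]

/-- ORDER BOUND ON THE DIFF-ALGEBRA along a ring map `ψ : O → T` («arc»): if every value `D f` (`D` of order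
`≤ j < b`, `f ∈ J`) has `ψ`-image divisible by `m^{b−j}`, then every degree-`d` coefficient of an element of row 003's
`diffSubalgebra K O J b = O[⊕_{j<b} Diff^{(j)}(J) X^{b−j}]` has `ψ`-image divisible by `m^d` (generators, `+`, `·`,
`O`-scalars: exponents add). Target-generic form of W46's `arc_coeff_dvd_of_mem_diffSubalgebra`. [folklore] -/
theorem coeff_dvd_of_mem_diffSubalgebra (ψ : O →+* T) (m : T) {J : Ideal O} {b : ℕ}
    (hgen : ∀ j < b, ∀ D : O →ₗ[K] O, IsDiffOpLE K j D → ∀ f ∈ J, m ^ (b - j) ∣ ψ (D f))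
    {P : Polynomial O} (hP : P ∈ diffSubalgebra K O J b) (d : ℕ) : m ^ d ∣ ψ (P.coeff d) := by
  classical
  unfold diffSubalgebra at hP
  induction hP using Algebra.adjoin_induction generalizing d with
  | mem P hP =>
    obtain ⟨j, hj, c, hc, rfl⟩ := hP
    rw [Polynomial.coeff_monomial]
    split_ifs with hd
    · subst hd
      have hle : diffIdeal K j J ≤ (Ideal.span {m ^ (b - j)}).comap ψ :=
        (diffIdeal_le_iff K).mpr fun D hD f hf => by
          rw [Ideal.mem_comap, Ideal.mem_span_singleton]
          exact hgen j hj D hD f hf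
      have h := hle hc
      rw [Ideal.mem_comap, Ideal.mem_span_singleton] at h
      exact h
    · rw [map_zero]
      exact dvd_zero _
  | algebraMap r =>
    rw [← Polynomial.C_eq_algebraMap, Polynomial.coeff_C]
    split_ifs with hd
    · subst hd
      rw [pow_zero]
      exact one_dvd _
    · rw [map_zero]
      exact dvd_zero _
  | add P Q _ _ hP hQ =>
    rw [Polynomial.coeff_add, map_add]
    exact dvd_add (hP d) (hQ d)
  | mul P Q _ _ hP hQ =>
    rw [Polynomial.coeff_mul, map_sum]
    refine Finset.dvd_sum fun x hx => ?_
    rw [map_mul, ← Finset.mem_antidiagonal.mp hx, pow_add]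
    exact mul_dvd_mul (hP x.1) (hQ x.2)

/-- PRIME EXTRACTION FROM A MONIC RELATION, bare hands (W46's `pow_dvd_of_monic_relation` with the prime `X` of `K[τ]`
replaced by any prime `π` of a domain): if `w^N + Σ_{i<N} c_i w^i = 0` with `π^{(N−i)M} ∣ c_i` then `π^M ∣ w`
(induction on `k ≤ M`: `π^k ∣ w` and `k < M` give `π^{Nk+1} ∣ w^N`, hence `π ∣ (w/π^k)^N`, hence `π^{k+1} ∣ w`).
[folklore] -/
theorem pow_dvd_of_monic_relation_prime [IsDomain T] {π : T} (hπ : Prime π) {N M : ℕ} {w : T} (c : ℕ → T)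
    (hcN : c N = 1) (hc : ∀ i < N, π ^ ((N - i) * M) ∣ c i)
    (hsum : ∑ i ∈ Finset.range (N + 1), c i * w ^ i = 0) : π ^ M ∣ w := by
  have hrel : w ^ N = -∑ i ∈ Finset.range N, c i * w ^ i := by
    rw [Finset.sum_range_succ, hcN, one_mul] at hsum
    linear_combination hsum
  suffices key : ∀ k, k ≤ M → π ^ k ∣ w from key M le_rfl
  intro k
  induction k with
  | zero =>
    intro _
    exact ⟨w, by rw [pow_zero, one_mul]⟩
  | succ k ih =>
    intro hk
    obtain ⟨w', hw'⟩ := ih (Nat.le_of_succ_le hk)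
    have hdiv : π ^ (N * k + 1) ∣ (π ^ k) ^ N * w' ^ N := by
      rw [← mul_pow, ← hw', hrel, dvd_neg]
      refine Finset.dvd_sum fun i hi => ?_
      have hi' : i < N := Finset.mem_range.mp hi
      obtain ⟨e, he⟩ := hc i hi'
      rw [he, hw', mul_pow, ← pow_mul]
      have hexp : N * k + 1 ≤ (N - i) * M + k * i := by
        obtain ⟨t, ht⟩ := Nat.exists_eq_add_of_lt hi'
        obtain ⟨s, hs⟩ := Nat.exists_eq_add_of_le hk
        have hNi : N - i = t + 1 := by omega
        rw [hNi, hs, ht]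
        nlinarith [Nat.zero_le (t * s), Nat.zero_le t, Nat.zero_le s, Nat.zero_le (k * i)]
      calc π ^ (N * k + 1)
          ∣ π ^ ((N - i) * M + k * i) := pow_dvd_pow _ hexp
        _ ∣ π ^ ((N - i) * M) * e * (π ^ (k * i) * w' ^ i) :=
            ⟨e * w' ^ i, by rw [pow_add]; ring⟩
    rw [← pow_mul, mul_comm k N, pow_succ] at hdiv
    have hX : π ∣ w' ^ N :=
      (mul_dvd_mul_iff_left (pow_ne_zero _ hπ.ne_zero)).mp hdiv
    obtain ⟨w'', hw''⟩ := hπ.dvd_of_dvd_pow hX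
    exact ⟨w'', by rw [hw', hw'', pow_succ, mul_assoc]⟩

/-- **THE ARC LEMMA, target-generic, prime by prime.** Under the generator bound of
`coeff_dvd_of_mem_diffSubalgebra`, if `a·X^k` lies in the typed ALGEBRAIC `℘ = pAlgebraicRing K O J b` (the INTEGRAL
CLOSURE of the Diff-algebra in `O[X]`, row 003 U17_2) then `π^{e·k} ∣ ψ a` for every prime power `π^e ∣ m` of the
domain `T`: the degree-`kN` coefficient of a monic integral relation of `a X^k` over the Diff-algebra is a monic relation
for `a` whose `i`-th coefficient is a degree-`k(N−i)` coefficient of the algebra. (W46's `arc_dvd_of_monomial_mem`,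
generalised.) [folklore] -/
theorem prime_pow_dvd_of_monomial_mem [IsDomain T] (ψ : O →+* T) (m : T) {J : Ideal O} {b : ℕ}
    (hgen : ∀ j < b, ∀ D : O →ₗ[K] O, IsDiffOpLE K j D → ∀ f ∈ J, m ^ (b - j) ∣ ψ (D f))
    {π : T} (hπ : Prime π) {e : ℕ} (he : π ^ e ∣ m) {k : ℕ} {a : O}
    (ha : Polynomial.monomial k a ∈ pAlgebraicRing K O J b) : π ^ (e * k) ∣ ψ a := by
  classical
  have hint : IsIntegral (diffSubalgebra K O J b) (Polynomial.monomial k a) := by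
    have h' := ha
    rw [pAlgebraicRing, Subalgebra.mem_restrictScalars, mem_integralClosure_iff] at h'
    exact h'
  obtain ⟨P, hmonic, heval⟩ := hint
  obtain ⟨N, hN⟩ : ∃ N, P.natDegree = N := ⟨_, rfl⟩
  have hcN : P.coeff N = 1 := hN ▸ hmonic.coeff_natDegree
  rw [Polynomial.eval₂_eq_sum_range, hN] at heval
  set c : ℕ → O := fun i =>
    ((P.coeff i : diffSubalgebra K O J b) : Polynomial O).coeff (k * (N - i)) with hc
  have hterm : ∀ i ∈ Finset.range (N + 1),
      ((algebraMap (diffSubalgebra K O J b) (Polynomial O) (P.coeff i)) *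
          (Polynomial.monomial k a) ^ i).coeff (k * N) = c i * a ^ i := by
    intro i hi
    have hi' : i ≤ N := Nat.lt_succ_iff.mp (Finset.mem_range.mp hi)
    have hsplit : k * N = k * (N - i) + k * i := by rw [← mul_add, Nat.sub_add_cancel hi']
    rw [Polynomial.monomial_pow, Subalgebra.algebraMap_apply, hsplit, Polynomial.coeff_mul_monomial]
  have hcoef : ∑ i ∈ Finset.range (N + 1), c i * a ^ i = 0 := by
    have h0 := congrArg (fun Q : Polynomial O => Q.coeff (k * N)) heval
    simp only [Polynomial.finsetSum_coeff, Polynomial.coeff_zero] at h0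
    rw [Finset.sum_congr rfl hterm] at h0
    exact h0
  have hsum : ∑ i ∈ Finset.range (N + 1), ψ (c i) * (ψ a) ^ i = 0 := by
    have h0 := congrArg ψ hcoef
    rw [map_sum, map_zero] at h0
    simpa only [map_mul, map_pow] using h0
  refine pow_dvd_of_monic_relation_prime hπ (fun i => ψ (c i)) ?_ ?_ hsum
  · simp only [hc, hcN, OneMemClass.coe_one, Nat.sub_self, mul_zero, Polynomial.coeff_one_zero, map_one]
  · intro i _
    have h0 := coeff_dvd_of_mem_diffSubalgebra ψ m hgen (P.coeff i).2 (k * (N - i))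
    have h1 : π ^ ((N - i) * (e * k)) ∣ m ^ (k * (N - i)) := by
      rw [show (N - i) * (e * k) = e * (k * (N - i)) by ring, pow_mul]
      exact pow_dvd_pow_of_dvd he _
    exact h1.trans h0

end Generic

/-! ## §2 Grothendieck's operators of order `≤ 0`, abstractly (order `≤ 1`: tree `W13.apply_mul_of_isDiffOpLE_one`) -/

section Order

variable {R : Type u} {A : Type v} [CommRing R] [CommRing A] [Algebra R A]

/-- Order `≤ 0` operators are multiplications: `D f = D(1)·f` (tree `isDiffOpLE_zero_iff_eq_mulLeft`). [folklore] -/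
theorem apply_eq_mul_of_isDiffOpLE_zero {D : A →ₗ[R] A} (hD : IsDiffOpLE R 0 D) (f : A) : D f = D 1 * f := by
  have h := congrArg (fun L : A →ₗ[R] A => L f) (isDiffOpLE_zero_iff_eq_mulLeft.mp hD)
  simpa only [LinearMap.mulLeft_apply] using h

end Order

/-! ## §3 W1 = `(y² + xw², 2) ⊂ 𝔸³_{𝔽₂}` (`Nega.g3`, frame `0 = x`, `1 = y`, `2 = w`): the generator bound along any arc -/

section W1Generators

variable {T : Type v} [CommRing T]

/-- For an operator `D` of order `≤ 1` on `𝔽₂[x,y,w]` (Grothendieck's sense, `𝔽₂`-linear):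
`D(y² + xw²) = −y²·D(1) + w²·D(x)` — squares contribute only through `D(1)` in characteristic `2`. [folklore] -/
theorem W1_apply_g3_of_isDiffOpLE_one
    {D : MvPolynomial (Fin 3) (ZMod 2) →ₗ[ZMod 2] MvPolynomial (Fin 3) (ZMod 2)} (hD : IsDiffOpLE (ZMod 2) 1 D) :
    D Nega.g3 = -(X 1 ^ 2 * D 1) + X 2 ^ 2 * D (X 0) := by
  have e1 := apply_mul_of_isDiffOpLE_one hD (X 1) (X 1)
  have e2 := apply_mul_of_isDiffOpLE_one hD (X 2) (X 2)
  have e3 := apply_mul_of_isDiffOpLE_one hD (X 0) (X 2 * X 2)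
  have hg : Nega.g3 = X 1 * X 1 + X 0 * (X 2 * X 2) := by rw [Nega.g3]; ring
  have h2 : (2 : MvPolynomial (Fin 3) (ZMod 2)) = 0 := CharTwo.two_eq_zero
  rw [hg, map_add, e1, e3, e2]
  linear_combination (X 1 * D (X 1) + X 0 * X 2 * D (X 2) - X 0 * X 2 * X 2 * D 1) * h2

/-- **GENERATOR BOUND for W1 along any arc.** For every ring map `ψ : 𝔽₂[x,y,w] → T` KILLING `g = y² + xw²`
(an «arc through the hypersurface»), every `f ∈ (g)` and every operator `D` of order `≤ j < 2`:
`(ψ(w)²)^{2−j} ∣ ψ(D f)` — order `0`: `D f ∈ (g) ↦ 0`; order `1`: `D(ug) = u·Dg + g·Du − ug·D1 ↦ ψ(u)·ψ(Dg)` and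
`ψ(Dg) = ψ(w)²·(ψ(x)ψ(D1) + ψ(Dx))` by `W1_apply_g3_of_isDiffOpLE_one` and `ψ(y)² = −ψ(x)ψ(w)²`. So the degree-one
generators `Diff^{(1)}(g)·X` of `℘(Ě_{W1})` have arc order `≥` that of `w²`, the degree-two generators `(g)·X²`
infinite arc order. [folklore] -/
theorem W1_gen_dvd (ψ : MvPolynomial (Fin 3) (ZMod 2) →+* T) (hψ : ψ Nega.g3 = 0) {j : ℕ} (hj : j < 2)
    {D : MvPolynomial (Fin 3) (ZMod 2) →ₗ[ZMod 2] MvPolynomial (Fin 3) (ZMod 2)} (hD : IsDiffOpLE (ZMod 2) j D)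
    {f : MvPolynomial (Fin 3) (ZMod 2)} (hf : f ∈ Ideal.span {Nega.g3}) :
    (ψ (X 2) ^ 2) ^ (2 - j) ∣ ψ (D f) := by
  obtain ⟨u, rfl⟩ := Ideal.mem_span_singleton'.mp hf
  have hψ' : ψ (X 1) ^ 2 + ψ (X 0) * ψ (X 2) ^ 2 = 0 := by
    have h := hψ
    rw [Nega.g3, map_add, map_mul, map_pow, map_pow] at h
    exact h
  interval_cases j
  · rw [apply_eq_mul_of_isDiffOpLE_zero hD, map_mul, map_mul, hψ, mul_zero, mul_zero]
    exact dvd_zero _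
  · refine ⟨ψ u * (ψ (X 0) * ψ (D 1) + ψ (D (X 0))), ?_⟩
    rw [apply_mul_of_isDiffOpLE_one hD, W1_apply_g3_of_isDiffOpLE_one hD]
    simp only [map_add, map_sub, map_mul, map_neg, map_pow, hψ]
    linear_combination (-(ψ u * ψ (D 1))) * hψ'

/-- **W1 ARC BOUND on `℘(Ě_{W1}, k)`, prime by prime, ALL `k`, closure included**: for an arc `ψ` killing `g` into a
domain and a prime power `π^e ∣ ψ(w)²`, every `a` with `a·X^k ∈ ℘(Ě_{W1})` (typed algebraic `℘`, `b = 2`) has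
`π^{e·k} ∣ ψ(a)`. [folklore] -/
theorem W1_prime_pow_dvd [IsDomain T] (ψ : MvPolynomial (Fin 3) (ZMod 2) →+* T) (hψ : ψ Nega.g3 = 0)
    {π : T} (hπ : Prime π) {e : ℕ} (he : π ^ e ∣ ψ (X 2) ^ 2) {k : ℕ} {a : MvPolynomial (Fin 3) (ZMod 2)}
    (ha : Polynomial.monomial k a ∈
      pAlgebraicRing (ZMod 2) (MvPolynomial (Fin 3) (ZMod 2)) (Ideal.span {Nega.g3}) 2) :
    π ^ (e * k) ∣ ψ a :=
  prime_pow_dvd_of_monomial_mem ψ (ψ (X 2) ^ 2) (fun _ hj _ hD _ hf => W1_gen_dvd ψ hψ hj hD hf) hπ he ha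

end W1Generators

/-! ## §4 The Frobenius arc `φ : 𝔽₂[x,y,w] → 𝔽₂[s,t]`, `x ↦ s²`, `y ↦ s t²`, `w ↦ t²`; primes of `𝔽₂[s,t]` -/

section FrobArc

/-- `X i` is prime in `𝔽₂[X₀, X₁]` (kernel of `X i ↦ 0` onto a domain; tree `isPrime_span_X_image`). [folklore] -/
theorem prime_X_fin2 (i : Fin 2) : Prime (X i : MvPolynomial (Fin 2) (ZMod 2)) := by
  have h := Literature.RingTheory.MvPolynomial.isPrime_span_X_image (R := ZMod 2) ({i} : Set (Fin 2))
  rw [Set.image_singleton] at h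
  exact (Ideal.span_singleton_prime (MvPolynomial.X_ne_zero i)).mp h

/-- `X 1 ∤ X 0 ^ n` in `𝔽₂[X₀, X₁]`. [folklore] -/
theorem not_X_one_dvd_X_zero_pow (n : ℕ) :
    ¬ (X 1 : MvPolynomial (Fin 2) (ZMod 2)) ∣ X 0 ^ n := fun h => by
  have h' := (prime_X_fin2 1).dvd_of_dvd_pow h
  rw [MvPolynomial.X_dvd_X] at h'
  exact absurd h' (by decide)

/-- Halving a prime multiplicity: `π^{2n} ∣ c²` gives `π^n ∣ c` (multiplicities of a prime add). [folklore] -/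
theorem pow_dvd_of_sq {α : Type v} [CommMonoidWithZero α] [IsCancelMulZero α] {π : α} (hπ : Prime π) {n : ℕ} {c : α}
    (h : π ^ (2 * n) ∣ c ^ 2) : π ^ n ∣ c := by
  rw [pow_dvd_iff_le_emultiplicity] at h ⊢
  rw [emultiplicity_pow hπ] at h
  generalize emultiplicity π c = E at h ⊢
  induction E using ENat.recTopCoe with
  | top => exact le_top
  | coe m =>
    have h' : ((2 * n : ℕ) : ℕ∞) ≤ ((2 * m : ℕ) : ℕ∞) := by
      rw [Nat.cast_mul, Nat.cast_mul]
      exact h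
    have h'' : 2 * n ≤ 2 * m := by exact_mod_cast h'
    exact_mod_cast (by omega : n ≤ m)

variable (φ : MvPolynomial (Fin 3) (ZMod 2) →ₐ[ZMod 2] MvPolynomial (Fin 2) (ZMod 2))

/-- The Frobenius arc KILLS `g`: `(s t²)² + s²·(t²)² = 2·s²t⁴ = 0` — `g = (y + √x·w)²` is purely inseparable over the
base `𝔽₂[x,w]`, and the arc adjoins `√x = s`. [folklore] -/
theorem frobArc_g3 (hφ0 : φ (X 0) = X 0 ^ 2) (hφ1 : φ (X 1) = X 0 * X 1 ^ 2) (hφ2 : φ (X 2) = X 1 ^ 2) :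
    φ Nega.g3 = 0 := by
  have h2 : (2 : MvPolynomial (Fin 2) (ZMod 2)) = 0 := CharTwo.two_eq_zero
  rw [Nega.g3, map_add, map_mul, map_pow, map_pow, hφ0, hφ1, hφ2]
  linear_combination (X 0 ^ 2 * X 1 ^ 4 : MvPolynomial (Fin 2) (ZMod 2)) * h2

/-- ON THE BASE THE ARC IS THE FROBENIUS: along `β^* = rename ![0,2] : 𝔽₂[x,w] → 𝔽₂[x,y,w]` (projection off `y`,
as in p486835) the arc is `x ↦ s²`, `w ↦ t²`, i.e. `MvPolynomial.expand 2`, which over `𝔽₂` is `c ↦ c²`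
(`MvPolynomial.expand_zmod`). [folklore] -/
theorem frobArc_rename (hφ0 : φ (X 0) = X 0 ^ 2) (hφ2 : φ (X 2) = X 1 ^ 2) (c : MvPolynomial (Fin 2) (ZMod 2)) :
    φ (rename ![(0 : Fin 3), 2] c) = c ^ 2 := by
  have h : φ.comp (rename ![(0 : Fin 3), 2]) = MvPolynomial.expand 2 := by
    apply MvPolynomial.algHom_ext
    intro i
    fin_cases i
    · simp [hφ0, MvPolynomial.expand_X]
    · simp [hφ2, MvPolynomial.expand_X]
  have h' := congrArg (fun F : MvPolynomial (Fin 2) (ZMod 2) →ₐ[ZMod 2] MvPolynomial (Fin 2) (ZMod 2) => F c) h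
  simp only [AlgHom.comp_apply] at h'
  rw [h', MvPolynomial.expand_zmod]

/-- Composed with the `x`-chart `σ = Nega.xChart` (`y ↦ xy₁`, `w ↦ xw₁`) the arc still kills `g`
(`σ g = x²·g′`, `Nega.xChart_g3`, and `g′` has the same shape). [folklore] -/
theorem frobArc_xChart_g3 (hφ0 : φ (X 0) = X 0 ^ 2) (hφ1 : φ (X 1) = X 0 * X 1 ^ 2) (hφ2 : φ (X 2) = X 1 ^ 2) :
    (φ.toRingHom.comp Nega.xChart.toRingHom) Nega.g3 = 0 := by
  have h : φ Nega.g3' = 0 := frobArc_g3 φ hφ0 hφ1 hφ2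
  rw [RingHom.comp_apply, AlgHom.toRingHom_eq_coe, AlgHom.toRingHom_eq_coe, RingHom.coe_coe, RingHom.coe_coe,
    Nega.xChart_g3, map_mul, h, mul_zero]

/-- The composed arc on `x`: `ψ(x) = s²`. [folklore] -/
theorem frobArc_xChart_X0 (hφ0 : φ (X 0) = X 0 ^ 2) :
    (φ.toRingHom.comp Nega.xChart.toRingHom) (X 0) = X 0 ^ 2 := by
  simp [Nega.xChart, hφ0]

/-- The composed arc on `w`: `ψ(w) = φ(x w₁) = s²t²`. [folklore] -/
theorem frobArc_xChart_X2 (hφ0 : φ (X 0) = X 0 ^ 2) (hφ2 : φ (X 2) = X 1 ^ 2) :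
    (φ.toRingHom.comp Nega.xChart.toRingHom) (X 2) = X 0 ^ 2 * X 1 ^ 2 := by
  simp [Nega.xChart, hφ0, hφ2]

end FrobArc

end Summit.ResolutionOfSingularities.ResolutionOfSingularities.Theorems.Campaign.W14.Law

end
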